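import Summits.CriticalPhenomena.PercolationContinuityZ3.Theses.PercNearOneGluing
import Summits.CriticalPhenomena.PercolationContinuityZ3.Theorems.PercNearOneGluingNoHeavyLowerTailReduction
import Summits.CriticalPhenomena.PercolationContinuityZ3.Theorems.PercNearOneGluingNoHeavyLowerTailResidualOfNearOneGluing
import Summits.CriticalPhenomena.PercolationContinuityZ3.Theorems.PercNearOneGluingNoHeavyLowerTailAdditiveLemma13
import Summits.CriticalPhenomena.PercolationContinuityZ3.Theorems.PercNearOneGluingHalfWeightReduction
import Summits.CriticalPhenomena.PercolationContinuityZ3.Theorems.PercNearOneGluingAdditiveGluingSuffices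
import Summits.CriticalPhenomena.PercolationContinuityZ3.Theorems.PercNearOneGluingAdditiveGluingOneBond
import Literature.Probability.Percolation.TreeGraphBound
import Literature.Probability.Percolation.PercolationProofs
import HarnessLib

/-!
# `NoHeavyLowerTail` (stmt-CriticalPhenomena-4575) — typed reductions of the live lines to the crux

Sorry-free glue for the typed skeleton of the crux (typing seat r2, 2026-08-17).  Each theorem discharges the crux
`Summit.CriticalPhenomena.PercolationContinuityZ3.Theses.PercNearOneGluing.NoHeavyLowerTail` (or its many-finger residual) from ONE explicitly
typed open kernel, so that a prover closing that kernel closes the crux by `exact <this theorem> <kernel proof>`: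

* `noHeavyLowerTail_of_oneCut` — the ONE-CUT BOUND (ttrl engine conjecture at `ρ = 1/2`, slack form:
  `P(1 ≤ N ∧ N < EN/2) ≤ t` whenever every pairwise disconnection among distinct relays is `≤ t`) ⇒ crux, with `δ := ε/2`.
* `manyFingersLargePocket_of_fatMinorityLinear`, `noHeavyLowerTail_of_fatMinorityLinear` — the FAT-MINORITY LINEAR bound
  (`∃ d₀ C, P(d₀ < N ∧ 2N ≤ |A|) ≤ C·(P(o ↮ A) + η)`, observer outside `A`) ⇒ residual ⇒ crux, with `δ := ε/(2(C+1))`.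
* `noHeavyLowerTail_of_nearOneGluingHalf` — Kozma–Nitzan Conjecture 3 at uniform density `1/2` on simple graphs ⇒ crux
  (`halfWeightReduction_proof` + `manyFingersLargePocket_of_nearOneGluing` + `noHeavyLowerTail_of_manyFingersLargePocket`).
* `additiveGluing_of_additiveConjecture1`, `noHeavyLowerTail_of_additiveConjecture1` — additive Conjecture 1 ⇒ `AdditiveGluing` ⇒ crux.
* `noHeavyLowerTail_of_additiveShorteningStep` — the ADDITIVE SHORTENING STEP of line additive-shortening (lead c7's registered
  sub-goal) ⇒ crux, via the landed `stub_additiveLemma13` (p172087).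
* `additiveConjecture1_of_commonRelay`, `noHeavyLowerTail_of_commonRelay` — the COMMON-RELAY interpolation step + the deterministic
  0/1 base ⇒ additive Conjecture 1 ⇒ crux (strong induction on the number of fractional pairs, `stub_oneBondDecomp_k15`).

No new mathematics: bookkeeping only (thresholds, filters, one-bond affine algebra).
-/

noncomputable section

namespace Summit.CriticalPhenomena.PercolationContinuityZ3.Theorems

open MeasureTheory Set Literature.Probability.LatticeModels Literature.Probability.Percolation
open Summit.CriticalPhenomena.PercolationContinuityZ3.Theses.PercNearOneGluing
open scoped Classical BigOperators

/-! ## One-cut bound ⇒ crux -/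

/-- **One-cut bound ⇒ `NoHeavyLowerTail`** (`δ := ε/2`; the reach hypothesis H1 is not needed). -/
theorem noHeavyLowerTail_of_oneCut :
    (∀ (n : ℕ) (w : Sym2 (Fin n) → unitInterval) (A : Finset (Fin n)) (o : Fin n) (t : ℝ), 0 ≤ t → (∀ a ∈ A, ∀ a' ∈ A, a ≠ a' → (Literature.Probability.LatticeModels.prodBernoulli w).real (Literature.Probability.Percolation.openConn a a')ᶜ ≤ t) → (Literature.Probability.LatticeModels.prodBernoulli w).real {ω : Literature.Probability.Percolation.BondConfig (Fin n) | 1 ≤ (A.filter fun a => ω ∈ Literature.Probability.Percolation.openConn o a).card ∧ ((A.filter fun a => ω ∈ Literature.Probability.Percolation.openConn o a).card : ℝ) < (∑ a ∈ A, (Literature.Probability.LatticeModels.prodBernoulli w).real (Literature.Probability.Percolation.openConn o a)) / 2} ≤ t) →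
    Summit.CriticalPhenomena.PercolationContinuityZ3.Theses.PercNearOneGluing.NoHeavyLowerTail := by
  intro hcut ε hε
  refine ⟨ε / 2, half_pos hε, ?_⟩
  intro n w A o _hU hpair
  have ht : ∀ a ∈ A, ∀ a' ∈ A, a ≠ a' →
      (Literature.Probability.LatticeModels.prodBernoulli w).real (Literature.Probability.Percolation.openConn a a')ᶜ ≤ ε / 2 := by
    intro a ha a' ha' _
    rw [probReal_compl_eq_one_sub (measurableSet_openConn_holds a a')]
    linarith [hpair a ha a' ha']
  have key := hcut n w A o (ε / 2) (half_pos hε).le ht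
  have hthr : ∀ x : ℝ, ε / 2 * x / ε = x / 2 := fun x => by
    field_simp
  refine lt_of_le_of_lt (le_trans (measureReal_mono (fun ω hω => ?_) (measure_ne_top _ _)) key) (by linarith)
  simp only [Set.mem_setOf_eq] at hω ⊢
  exact ⟨hω.1, by rw [← hthr]; exact hω.2⟩

/-! ## Fat-minority linear bound ⇒ residual ⇒ crux -/

/-- **Fat-minority linear bound ⇒ the many-finger large-pocket residual** (`δ := ε/(2(C+1))`, same `d₀`, `s₀ := 0`). -/
theorem manyFingersLargePocket_of_fatMinorityLinear :
    (∃ (d₀ : ℕ) (C : ℝ), 0 ≤ C ∧ ∀ (n : ℕ) (w : Sym2 (Fin n) → unitInterval) (A : Finset (Fin n)) (o : Fin n) (η : ℝ), 0 ≤ η → o ∉ A → (∀ a ∈ A, ∀ a' ∈ A, (Literature.Probability.LatticeModels.prodBernoulli w).real (Literature.Probability.Percolation.openConn a a')ᶜ ≤ η) → (Literature.Probability.LatticeModels.prodBernoulli w).real {ω : Literature.Probability.Percolation.BondConfig (Fin n) | d₀ < (A.filter fun a => ω ∈ Literature.Probability.Percolation.openConn o a).card ∧ 2 * (A.filter fun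 a => ω ∈ Literature.Probability.Percolation.openConn o a).card ≤ A.card} ≤ C * ((Literature.Probability.LatticeModels.prodBernoulli w).real (⋃ a ∈ A, Literature.Probability.Percolation.openConn o a)ᶜ + η)) →
    (∀ ε : ℝ, 0 < ε → ∃ (δ : ℝ) (d₀ s₀ : ℕ), 0 < δ ∧ ∀ (n : ℕ) (w : Sym2 (Fin n) → unitInterval) (A : Finset (Fin n)) (o a₀ : Fin n), a₀ ∈ A → o ∉ A → (∀ a ∈ A, ∀ a' ∈ A, (Literature.Probability.LatticeModels.prodBernoulli w).real (Literature.Probability.Percolation.openConn a a')ᶜ ≤ δ) → (Literature.Probability.LatticeModels.prodBernoulli w).real (⋃ a ∈ A, Literature.Probability.Percolation.openConn o a)ᶜ ≤ δ → (Literature.Probability.LatticeModels.prodBernoulli w).real {ω : Literature.Probability.Percolation.BondConfig (Fin n) | ω ∉ Literature.Probability.Percolation.openConn o a₀ ∧ s₀ ≤ ((A.erase a₀).filter fun a => ω ∈ Literature.Probability.Percolation.openConn o a).card ∧ 2 * ((A.erase a₀).filter fun a => ω ∈ Literature.Probability.Percolation.openConn o a).card ≤ A.card ∧ d₀ < (A.filter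 fun a => ω ∈ Literature.Probability.Percolation.openConnIn ((↑A : Set (Fin n))ᶜ ∪ {o, a}) o a).card} ≤ ε) := by
  rintro ⟨d₀, C, hC, hF⟩
  intro ε hε
  refine ⟨ε / (2 * (C + 1)), d₀, 0, by positivity, fun n w A o a₀ ha₀ ho hpair hobs => ?_⟩
  have key := hF n w A o (ε / (2 * (C + 1))) (by positivity) ho hpair
  have hfilter : ∀ ω : Literature.Probability.Percolation.BondConfig (Fin n), ω ∉ Literature.Probability.Percolation.openConn o a₀ →
      (A.filter fun a => ω ∈ Literature.Probability.Percolation.openConn o a) =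
        ((A.erase a₀).filter fun a => ω ∈ Literature.Probability.Percolation.openConn o a) := by
    intro ω hω
    rw [Finset.filter_erase, Finset.erase_eq_of_notMem]
    simp [Finset.mem_filter, hω]
  calc (Literature.Probability.LatticeModels.prodBernoulli w).real {ω : Literature.Probability.Percolation.BondConfig (Fin n) | ω ∉ Literature.Probability.Percolation.openConn o a₀ ∧
          0 ≤ ((A.erase a₀).filter fun a => ω ∈ Literature.Probability.Percolation.openConn o a).card ∧
          2 * ((A.erase a₀).filter fun a => ω ∈ Literature.Probability.Percolation.openConn o a).card ≤ A.card ∧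
          d₀ < (A.filter fun a => ω ∈ Literature.Probability.Percolation.openConnIn ((↑A : Set (Fin n))ᶜ ∪ {o, a}) o a).card}
      ≤ (Literature.Probability.LatticeModels.prodBernoulli w).real {ω : Literature.Probability.Percolation.BondConfig (Fin n) | d₀ < (A.filter fun a => ω ∈ Literature.Probability.Percolation.openConn o a).card ∧
          2 * (A.filter fun a => ω ∈ Literature.Probability.Percolation.openConn o a).card ≤ A.card} := by
        refine measureReal_mono (fun ω hω => ?_) (measure_ne_top _ _)
        simp only [Set.mem_setOf_eq] at hω ⊢
        obtain ⟨h1, -, h3, h4⟩ := hω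
        refine ⟨lt_of_lt_of_le h4 (Finset.card_le_card ?_), by rw [hfilter ω h1]; exact h3⟩
        intro a
        simp only [Finset.mem_filter]
        exact fun ha => ⟨ha.1, openConnIn_subset_openConn _ _ _ ha.2⟩
    _ ≤ C * ((Literature.Probability.LatticeModels.prodBernoulli w).real (⋃ a ∈ A, Literature.Probability.Percolation.openConn o a)ᶜ + ε / (2 * (C + 1))) := key
    _ ≤ C * (ε / (2 * (C + 1)) + ε / (2 * (C + 1))) := by gcongr
    _ ≤ ε := by
        have hC1 : (0 : ℝ) < C + 1 := by positivity
        have : C * (ε / (2 * (C + 1)) + ε / (2 * (C + 1))) = C * ε / (C + 1) := by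
          field_simp; ring
        rw [this, div_le_iff₀ hC1]
        nlinarith

/-- **Fat-minority linear bound ⇒ `NoHeavyLowerTail`.** -/
theorem noHeavyLowerTail_of_fatMinorityLinear :
    (∃ (d₀ : ℕ) (C : ℝ), 0 ≤ C ∧ ∀ (n : ℕ) (w : Sym2 (Fin n) → unitInterval) (A : Finset (Fin n)) (o : Fin n) (η : ℝ), 0 ≤ η → o ∉ A → (∀ a ∈ A, ∀ a' ∈ A, (Literature.Probability.LatticeModels.prodBernoulli w).real (Literature.Probability.Percolation.openConn a a')ᶜ ≤ η) → (Literature.Probability.LatticeModels.prodBernoulli w).real {ω : Literature.Probability.Percolation.BondConfig (Fin n) | d₀ < (A.filter fun a => ω ∈ Literature.Probability.Percolation.openConn o a).card ∧ 2 * (A.filter fun a => ω ∈ Literature.Probability.Percolation.openConn o a).card ≤ A.card} ≤ C * ((Literature.Probability.LatticeModels.prodBernoulli w).real (⋃ a ∈ A, Literature.Probability.Percolation.openConn o a)ᶜ + η)) →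
    Summit.CriticalPhenomena.PercolationContinuityZ3.Theses.PercNearOneGluing.NoHeavyLowerTail := fun hF =>
  noHeavyLowerTail_of_manyFingersLargePocket (manyFingersLargePocket_of_fatMinorityLinear hF)

/-! ## Conjecture 3 at density 1/2 ⇒ crux -/

/-- **Kozma–Nitzan Conjecture 3 at uniform density 1/2 (simple graphs) ⇒ `NoHeavyLowerTail`.** -/
theorem noHeavyLowerTail_of_nearOneGluingHalf :
    (∀ ε : ℝ, 0 < ε → ∃ δ : ℝ, 0 < δ ∧ ∀ (n : ℕ) (G : SimpleGraph (Fin n)) (A : Finset (Fin n)) (o b : Fin n), 1 - δ < (Literature.Probability.Percolation.bondPercolation G Literature.Probability.Percolation.half).real (⋃ a ∈ A, Literature.Probability.Percolation.openConn o a) → (∀ a ∈ A, 1 - δ < (Literature.Probability.Percolation.bondPercolation G Literature.Probability.Percolation.half).real (Literature.Probability.Percolation.openConn a b)) → 1 - ε < (Literature.Probability.Percolation.bondPercolation G Literature.Probability.Percolation.half).real (Literature.Probability.Percolation.openConn o b)) →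
    Summit.CriticalPhenomena.PercolationContinuityZ3.Theses.PercNearOneGluing.NoHeavyLowerTail := fun hHalf =>
  noHeavyLowerTail_of_manyFingersLargePocket
    (manyFingersLargePocket_of_nearOneGluing (halfWeightReduction_proof hHalf))

/-! ## Additive Conjecture 1 ⇒ AdditiveGluing ⇒ crux -/

/-- Additive Conjecture 1 (`P(o ↔ A) − (1 − t) ≤ P(o ↔ b)` when every relay has `P(a ↔ b) ≥ t`, `A ≠ ∅`) ⇒ `AdditiveGluing`. -/
theorem additiveGluing_of_additiveConjecture1 :
    (∀ (n : ℕ) (w : Sym2 (Fin n) → unitInterval) (A : Finset (Fin n)) (o b : Fin n) (t : ℝ), A.Nonempty → (∀ a ∈ A, t ≤ (prodBernoulli w).real (openConn a b)) → (prodBernoulli w).real (⋃ a ∈ A, openConn o a) - (1 - t) ≤ (prodBernoulli w).real (openConn o b)) → AdditiveGluing := by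
  intro hC n w A o b t ht hA
  rcases A.eq_empty_or_nonempty with hAe | hAne
  · subst hAe
    simp only [Finset.notMem_empty, Set.iUnion_of_empty, Set.iUnion_empty, measureReal_empty]
    linarith [measureReal_nonneg (μ := prodBernoulli w) (s := openConn o b)]
  · have key := hC n w A o b (1 - t) hAne (fun a ha => hA a ha)
    linarith

/-- Additive Conjecture 1 ⇒ `NoHeavyLowerTail`. -/
theorem noHeavyLowerTail_of_additiveConjecture1 :
    (∀ (n : ℕ) (w : Sym2 (Fin n) → unitInterval) (A : Finset (Fin n)) (o b : Fin n) (t : ℝ), A.Nonempty → (∀ a ∈ A, t ≤ (prodBernoulli w).real (openConn a b)) → (prodBernoulli w).real (⋃ a ∈ A, openConn o a) - (1 - t) ≤ (prodBernoulli w).real (openConn o b)) →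
    Summit.CriticalPhenomena.PercolationContinuityZ3.Theses.PercNearOneGluing.NoHeavyLowerTail := fun hC =>
  noHeavyLowerTail_of_manyFingersLargePocket
    (manyFingersLargePocket_of_nearOneGluing
      (additiveGluingSuffices_proof (additiveGluing_of_additiveConjecture1 hC)))

/-! ## The additive shortening step ⇒ crux (lead c7's registered sub-goal) -/

/-- **The additive shortening step ⇒ `NoHeavyLowerTail`**: step ⇒ additive Conjecture 1 (`stub_additiveLemma13`, landed) ⇒
`AdditiveGluing` ⇒ `NearOneGluing` ⇒ residual ⇒ crux. -/
theorem noHeavyLowerTail_of_additiveShorteningStep :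
    (∀ (n : ℕ) (w : Sym2 (Fin n) → unitInterval) (A : Finset (Fin n)) (b v x a₀ : Fin n), v ∉ A → v ≠ x → w s(v, x) = 0 → a₀ ∈ A → (∀ a ∈ A, (prodBernoulli w).real (openConn a₀ b) ≤ (prodBernoulli w).real (openConn a b)) → (∀ w' : Sym2 (Fin n) → unitInterval, (∀ e, w e = 0 → w' e = 0) → ∀ (A' : Finset (Fin n)) (o' b' : Fin n) (t : ℝ), A'.Nonempty → (∀ a ∈ A', t ≤ (prodBernoulli w').real (openConn a b')) → (prodBernoulli w').real (⋃ a ∈ A', openConn o' a) - (1 - t) ≤ (prodBernoulli w').real (openConn o' b')) → (prodBernoulli (Function.update w s(v, x) 1)).real (⋃ a ∈ A, openConn v a) - (1 - (prodBernoulli (Function.update w s(v, x) 1)).real (openConn a₀ b)) ≤ (prodBernoulli (Function.update w s(v, x) 1)).real (openConn v b)) → Summit.CriticalPhenomena.PercolationContinuityZ3.Theses.PercNearOneGluing.NoHeavyLowerTail := fun hstep =>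
  noHeavyLowerTail_of_additiveConjecture1 (stub_additiveLemma13 hstep)

/-! ## Common-relay interpolation + deterministic base ⇒ additive Conjecture 1 ⇒ crux -/

/-- The affine one-bond algebra of the common-relay line. -/
theorem commonRelay_affine_algebra {p X₀ X₁ Y₀ Y₁ Z₀ Z₁ t : ℝ} (hp0 : 0 ≤ p) (hp1 : p ≤ 1)
    (h0 : Y₀ - X₀ ≤ 1 - Z₀) (h1 : Y₁ - X₁ ≤ 1 - Z₁) (ht : t ≤ (1 - p) * Z₀ + p * Z₁) :
    ((1 - p) * Y₀ + p * Y₁) - (1 - t) ≤ (1 - p) * X₀ + p * X₁ := by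
  nlinarith [mul_le_mul_of_nonneg_left h0 (sub_nonneg.2 hp1), mul_le_mul_of_nonneg_left h1 hp0]

/-- **Common-relay step + deterministic base ⇒ additive Conjecture 1** (strong induction on the number of fractional pairs; both
interpolation endpoints `w[e ↦ 0]`, `w[e ↦ 1]` are induction hypotheses; one-bond decomposition `stub_oneBondDecomp_k15`). -/
theorem additiveConjecture1_of_commonRelay :
    (∀ (n : ℕ) (w : Sym2 (Fin n) → unitInterval) (A : Finset (Fin n)) (o b : Fin n), A.Nonempty → (∃ e : Sym2 (Fin n), 0 < (w e : ℝ) ∧ (w e : ℝ) < 1) → (∀ w' : Sym2 (Fin n) → unitInterval, (Finset.univ.filter fun e => 0 < (w' e : ℝ) ∧ (w' e : ℝ) < 1).card < (Finset.univ.filter fun e => 0 < (w e : ℝ) ∧ (w e : ℝ) < 1).card → ∀ (A' : Finset (Fin n)) (o' b' : Fin n) (t : ℝ), A'.Nonempty → (∀ a ∈ A', t ≤ (prodBernoulli w').real (openConn a b')) → (prodBernoulli w').real (⋃ a ∈ A', openConn o' a) - (1 - t) ≤ (prodBernoulli w').real (openConn o' b')) → ∃ e : Sym2 (Fin n), (0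 < (w e : ℝ) ∧ (w e : ℝ) < 1) ∧ ∃ a ∈ A, ((prodBernoulli (Function.update w e 0)).real (⋃ a' ∈ A, openConn o a') - (prodBernoulli (Function.update w e 0)).real (openConn o b) ≤ 1 - (prodBernoulli (Function.update w e 0)).real (openConn a b)) ∧ ((prodBernoulli (Function.update w e 1)).real (⋃ a' ∈ A, openConn o a') - (prodBernoulli (Function.update w e 1)).real (openConn o b) ≤ 1 - (prodBernoulli (Function.update w e 1)).real (openConn a b))) →
    (∀ (n : ℕ) (w : Sym2 (Fin n) → unitInterval), (∀ e : Sym2 (Fin n), (w e : ℝ) = 0 ∨ (w e : ℝ) = 1) → ∀ (A : Finset (Fin n)) (o b : Fin n) (t : ℝ), A.Nonempty → (∀ a ∈ A, t ≤ (prodBernoulli w).real (openConn a b)) → (prodBernoulli w).real (⋃ a ∈ A, openConn o a) - (1 - t) ≤ (prodBernoulli w).real (openConn o b)) →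
    ∀ (n : ℕ) (w : Sym2 (Fin n) → unitInterval) (A : Finset (Fin n)) (o b : Fin n) (t : ℝ), A.Nonempty → (∀ a ∈ A, t ≤ (prodBernoulli w).real (openConn a b)) → (prodBernoulli w).real (⋃ a ∈ A, openConn o a) - (1 - t) ≤ (prodBernoulli w).real (openConn o b) := by
  intro hCRL hBase n
  suffices H : ∀ k : ℕ, ∀ w : Sym2 (Fin n) → unitInterval,
      (Finset.univ.filter fun e => 0 < (w e : ℝ) ∧ (w e : ℝ) < 1).card = k →
      ∀ (A : Finset (Fin n)) (o b : Fin n) (t : ℝ), A.Nonempty →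
        (∀ a ∈ A, t ≤ (prodBernoulli w).real (openConn a b)) →
        (prodBernoulli w).real (⋃ a ∈ A, openConn o a) - (1 - t) ≤ (prodBernoulli w).real (openConn o b) by
    intro w A o b t hA ht
    exact H _ w rfl A o b t hA ht
  intro k
  induction k using Nat.strong_induction_on with
  | _ k ih =>
  intro w hk A o b t hA ht
  by_cases hfrac : ∃ e : Sym2 (Fin n), 0 < (w e : ℝ) ∧ (w e : ℝ) < 1
  · have hIH : ∀ w' : Sym2 (Fin n) → unitInterval,
        (Finset.univ.filter fun e => 0 < (w' e : ℝ) ∧ (w' e : ℝ) < 1).card <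
          (Finset.univ.filter fun e => 0 < (w e : ℝ) ∧ (w e : ℝ) < 1).card →
        ∀ (A' : Finset (Fin n)) (o' b' : Fin n) (t : ℝ), A'.Nonempty →
          (∀ a ∈ A', t ≤ (prodBernoulli w').real (openConn a b')) →
          (prodBernoulli w').real (⋃ a ∈ A', openConn o' a) - (1 - t) ≤
            (prodBernoulli w').real (openConn o' b') := by
      intro w' hlt A' o' b' t' hA' ht'
      exact ih _ (hk ▸ hlt) w' rfl A' o' b' t' hA' ht'
    obtain ⟨e, ⟨he0, he1⟩, a, ha, h0, h1⟩ := hCRL n w A o b hA hfrac hIH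
    have hX := stub_oneBondDecomp_k15 n w e (openConn o b)
    have hY := stub_oneBondDecomp_k15 n w e (⋃ a' ∈ A, openConn o a')
    have hZ := stub_oneBondDecomp_k15 n w e (openConn a b)
    have hta := ht a ha
    rw [hZ] at hta
    rw [hX, hY]
    exact commonRelay_affine_algebra he0.le he1.le h0 h1 hta
  · push Not at hfrac
    refine hBase n w (fun e => ?_) A o b t hA ht
    have h0 : 0 ≤ (w e : ℝ) := (w e).2.1
    have h1 : (w e : ℝ) ≤ 1 := (w e).2.2
    rcases h0.lt_or_eq with hpos | hzero
    · exact Or.inr (le_antisymm h1 (hfrac e hpos))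
    · exact Or.inl hzero.symm

/-- **Common-relay step + deterministic base ⇒ `NoHeavyLowerTail`.** -/
theorem noHeavyLowerTail_of_commonRelay :
    (∀ (n : ℕ) (w : Sym2 (Fin n) → unitInterval) (A : Finset (Fin n)) (o b : Fin n), A.Nonempty → (∃ e : Sym2 (Fin n), 0 < (w e : ℝ) ∧ (w e : ℝ) < 1) → (∀ w' : Sym2 (Fin n) → unitInterval, (Finset.univ.filter fun e => 0 < (w' e : ℝ) ∧ (w' e : ℝ) < 1).card < (Finset.univ.filter fun e => 0 < (w e : ℝ) ∧ (w e : ℝ) < 1).card → ∀ (A' : Finset (Fin n)) (o' b' : Fin n) (t : ℝ), A'.Nonempty → (∀ a ∈ A', t ≤ (prodBernoulli w').real (openConn a b')) → (prodBernoulli w').real (⋃ a ∈ A', openConn o' a) - (1 - t) ≤ (prodBernoulli w').real (openConn o' b')) → ∃ e : Sym2 (Fin n), (0 < (w e : ℝ) ∧ (w e : ℝ) < 1) ∧ ∃ a ∈ A, ((prodBernoulli (Function.update w e 0)).real (⋃ a' ∈ A, openConn o a') - (prodBernoulli (Function.update w e 0)).real (openConn o b) ≤ 1 - (prodBernoulli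 (Function.update w e 0)).real (openConn a b)) ∧ ((prodBernoulli (Function.update w e 1)).real (⋃ a' ∈ A, openConn o a') - (prodBernoulli (Function.update w e 1)).real (openConn o b) ≤ 1 - (prodBernoulli (Function.update w e 1)).real (openConn a b))) →
    (∀ (n : ℕ) (w : Sym2 (Fin n) → unitInterval), (∀ e : Sym2 (Fin n), (w e : ℝ) = 0 ∨ (w e : ℝ) = 1) → ∀ (A : Finset (Fin n)) (o b : Fin n) (t : ℝ), A.Nonempty → (∀ a ∈ A, t ≤ (prodBernoulli w).real (openConn a b)) → (prodBernoulli w).real (⋃ a ∈ A, openConn o a) - (1 - t) ≤ (prodBernoulli w).real (openConn o b)) →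
    Summit.CriticalPhenomena.PercolationContinuityZ3.Theses.PercNearOneGluing.NoHeavyLowerTail := fun hCRL hBase =>
  noHeavyLowerTail_of_additiveConjecture1 (additiveConjecture1_of_commonRelay hCRL hBase)

end Summit.CriticalPhenomena.PercolationContinuityZ3.Theorems

end
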